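import Mathlib
import Summits.NavierStokesRegularity.NavierStokesRegularity.Theorems.EulerZoomLiouvillePowerGaugeEulerLiouvilleChiralAnchorTransport
import Summits.NavierStokesRegularity.NavierStokesRegularity.Theorems.EulerZoomLiouvillePowerGaugeEulerLiouvilleChiralAnchorRaceTools
import Summits.NavierStokesRegularity.NavierStokesRegularity.Theorems.EulerZoomLiouvillePowerGaugeEulerLiouvilleBackwardTools
import Literature.Analysis.FluidPDE.TaoEnstrophyLocalisation
import HarnessLib

/-!
# Crux `EulerZoomLiouville.PowerGaugeEulerLiouville` (stmt-NavierStokesRegularity-19832), width sub-line `chiral_anchor` (ns-idea-11 g10, REV3),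
# stub K4 `stub_anchorRace` (THE RACE) — part (b): THE PER-TIME STEP

Seat ns-ezl-w3 g8 (`--supports stmt-NavierStokesRegularity-19832 --as helper`).  One slice of a classical Euler solution with the `A`-gauge
`a^{2ρ} A(u; Q_a) ≤ c`: if a weight `|w| ≤ 1` vanishing off a set of volume `≤ V̄` HOSTS helicity `w₀ H ≤ |∫_{B_R} w ⟪u(σ), curl u(σ)⟫|` at a time
`σ ∈ (−R², 0)`, then the shell helicity floor (hypothesis, the body of `ShellHelicityFloor` of `Lines/chiral_anchor.lean` for one constant `C`) forces the
enstrophy quantum `e = min(w₀H/(2Cκ₁V̄^{1/3}), (w₀H)² R^{1+2ρ}/(4C²κ₁²(c+1)V̄^{2/3})) ≤ ∫_{B_R} ‖∇u(σ)‖²` (`κ₁ = ‖curlCLM‖ + 1`):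
`ChiralAnchor.quantum_le_enstrophy` (real form) and `ChiralAnchor.ofReal_quantum_le_lintegral` (the `ℝ≥0∞` form the race integrates in time).
Ingredients: `ChiralAnchor.sq_ge_of_floor`, `Backward.lintegral_ball_le_of_gaugeA`, `norm_curl_le`.

HONEST FRAMING: one step of one stub of a width sub-line of the MODEL-lattice crux class; nothing about the crux E (19832 OPEN) or NS; not E. [folklore]
-/

noncomputable section

set_option linter.dupNamespace false

open MeasureTheory Set Filter Topology Metric Function InnerProductSpace
open scoped RealInnerProductSpace NNReal ENNReal ContDiff Topology

namespace Summit.NavierStokesRegularity.NavierStokesRegularity.Theorems.PowerGaugeEulerLiouville.ChiralAnchor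

open Literature.Analysis Literature.Analysis.FluidPDE
open Summit.NavierStokesRegularity.NavierStokesRegularity.Theorems.PowerGaugeEulerLiouville

variable {u : ℝ → EuclideanSpace ℝ (Fin 3) → EuclideanSpace ℝ (Fin 3)} {p : ℝ → EuclideanSpace ℝ (Fin 3) → ℝ}

/-- A continuous function is integrable on a ball of `ℝ³`. [folklore] -/
theorem integrableOn_ball_of_continuous {G : Type*} [NormedAddCommGroup G] {f : EuclideanSpace ℝ (Fin 3) → G} (hf : Continuous f)
    (R : ℝ) : IntegrableOn f (ball (0 : EuclideanSpace ℝ (Fin 3)) R) :=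
  (hf.continuousOn.integrableOn_compact (isCompact_closedBall (0 : EuclideanSpace ℝ (Fin 3)) R)).mono_set ball_subset_closedBall

/-- Real and `ℝ≥0∞` squared norms on a ball agree for a continuous field: `ENNReal.ofReal (∫_B ‖f‖²) = ∫⁻_B ‖f‖ₑ²`. [folklore] -/
theorem ofReal_setIntegral_norm_sq {G : Type*} [NormedAddCommGroup G] {f : EuclideanSpace ℝ (Fin 3) → G} (hf : Continuous f) (R : ℝ) :
    ENNReal.ofReal (∫ x in ball (0 : EuclideanSpace ℝ (Fin 3)) R, ‖f x‖ ^ 2) =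
      ∫⁻ x in ball (0 : EuclideanSpace ℝ (Fin 3)) R, ‖f x‖ₑ ^ 2 := by
  have hi : IntegrableOn (fun x => ‖f x‖ ^ 2) (ball (0 : EuclideanSpace ℝ (Fin 3)) R) :=
    integrableOn_ball_of_continuous (hf.norm.pow 2) R
  rw [ofReal_integral_eq_lintegral_ofReal hi (ae_of_all _ fun x => by positivity)]
  refine lintegral_congr fun x => ?_
  rw [ENNReal.ofReal_pow (norm_nonneg _), ofReal_norm]

/-- ★ **THE PER-TIME STEP (real form).**  Classical Euler on the open past with the `A`-gauge at exponent `ρ` and constant `c`; the floor for one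
constant `C`; a time `σ ∈ (−R², 0)`; a measurable weight `|w| ≤ 1` vanishing off a measurable set `T'` with `vol T' ≤ V̄` (`0 < V̄`, `vol T' < ∞`)
hosting `w₀ H ≤ |∫_{B_R} w ⟪u σ, curl (u σ)⟫|` (`w₀, H > 0`).  Then the quantum is paid: `e ≤ ∫_{B_R} ‖∇u(σ)‖²`. [folklore] -/
theorem quantum_le_enstrophy (hcl : IsClassicalEulerSolutionOn (Iio 0) 0 u p) {ρ : ℝ} {c : ℝ≥0}
    (hA : ∀ a : ℝ, 0 < a → ENNReal.ofReal (a ^ (2 * ρ)) * cknA a (0 : ℝ × EuclideanSpace ℝ (Fin 3)) u ≤ (c : ℝ≥0∞))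
    {C : ℝ} (hC : 0 < C)
    (hF : ∀ R : ℝ, 0 < R → ∀ v : EuclideanSpace ℝ (Fin 3) → EuclideanSpace ℝ (Fin 3), ContDiff ℝ 1 v →
      ∀ w : EuclideanSpace ℝ (Fin 3) → ℝ, Measurable w → (∀ x : EuclideanSpace ℝ (Fin 3), |w x| ≤ 1) →
        ∀ T : Set (EuclideanSpace ℝ (Fin 3)), MeasurableSet T → volume T < ⊤ → (∀ x : EuclideanSpace ℝ (Fin 3), x ∉ T → w x = 0) →
          |∫ x in Metric.ball (0 : EuclideanSpace ℝ (Fin 3)) R, w x * inner ℝ (v x) (curl v x)| ≤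
            C * (volume T).toReal ^ (1 / 3 : ℝ) *
                (Real.sqrt (∫ x in Metric.ball (0 : EuclideanSpace ℝ (Fin 3)) R, ‖fderiv ℝ v x‖ ^ 2) +
                  R⁻¹ * Real.sqrt (∫ x in Metric.ball (0 : EuclideanSpace ℝ (Fin 3)) R, ‖v x‖ ^ 2)) *
              Real.sqrt (∫ x in Metric.ball (0 : EuclideanSpace ℝ (Fin 3)) R, ‖curl v x‖ ^ 2))
    {R : ℝ} (hR : 0 < R) {σ : ℝ} (hσ : σ ∈ Ioo (-(R ^ 2)) 0)
    {w : EuclideanSpace ℝ (Fin 3) → ℝ} (hwm : Measurable w) (hw1 : ∀ x, |w x| ≤ 1)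
    {T' : Set (EuclideanSpace ℝ (Fin 3))} (hT'm : MeasurableSet T') (hT'fin : volume T' < ⊤) (hwT' : ∀ x, x ∉ T' → w x = 0)
    {V : ℝ} (hV : 0 < V) (hT'V : (volume T').toReal ≤ V)
    {w₀ H : ℝ} (hw₀ : 0 < w₀) (hH : 0 < H)
    (hhost : w₀ * H ≤ |∫ x in ball (0 : EuclideanSpace ℝ (Fin 3)) R, w x * ⟪u σ x, curl (u σ) x⟫|) :
    min (w₀ * H / (2 * C * (‖curlCLM‖ + 1) * V ^ (1 / 3 : ℝ)))
        ((w₀ * H) ^ 2 * R ^ (1 + 2 * ρ) / (4 * C ^ 2 * (‖curlCLM‖ + 1) ^ 2 * ((c : ℝ) + 1) * V ^ (2 / 3 : ℝ))) ≤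
      ∫ x in ball (0 : EuclideanSpace ℝ (Fin 3)) R, ‖fderiv ℝ (u σ) x‖ ^ 2 := by
  -- the slice and its continuity
  have hv : ContDiff ℝ ∞ (u σ) := hcl.contDiff_velocity hσ.2
  have hv1 : ContDiff ℝ 1 (u σ) := hv.of_le (by exact_mod_cast le_top)
  have hvc : Continuous (u σ) := hv.continuous
  have hDc : Continuous (fderiv ℝ (u σ)) := hv.continuous_fderiv (by simp)
  have hKc : Continuous (curl (u σ)) := by
    rw [curl_eq_curlCLM_comp]; exact curlCLM.continuous.comp hDc
  set ID : ℝ := ∫ x in ball (0 : EuclideanSpace ℝ (Fin 3)) R, ‖fderiv ℝ (u σ) x‖ ^ 2 with hIDdef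
  set IU : ℝ := ∫ x in ball (0 : EuclideanSpace ℝ (Fin 3)) R, ‖u σ x‖ ^ 2 with hIUdef
  set IK : ℝ := ∫ x in ball (0 : EuclideanSpace ℝ (Fin 3)) R, ‖curl (u σ) x‖ ^ 2 with hIKdef
  have hID0 : 0 ≤ ID := setIntegral_nonneg measurableSet_ball fun x _ => by positivity
  have hIU0 : 0 ≤ IU := setIntegral_nonneg measurableSet_ball fun x _ => by positivity
  -- the floor, with the volume factor replaced by `V̄`
  have hfloor := hF R hR (u σ) hv1 w hwm hw1 T' hT'm hT'fin hwT'
  have hV3 : (volume T').toReal ^ (1 / 3 : ℝ) ≤ V ^ (1 / 3 : ℝ) :=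
    Real.rpow_le_rpow ENNReal.toReal_nonneg hT'V (by norm_num)
  have h1 : w₀ * H ≤ C * V ^ (1 / 3 : ℝ) * (Real.sqrt ID + R⁻¹ * Real.sqrt IU) * Real.sqrt IK := by
    refine hhost.trans (hfloor.trans ?_)
    have hx : 0 ≤ Real.sqrt ID + R⁻¹ * Real.sqrt IU := by positivity
    have hy : 0 ≤ Real.sqrt IK := Real.sqrt_nonneg _
    gcongr
  -- `‖curl v‖_{L²} ≤ κ₁ ‖∇v‖_{L²}`
  have h2 : Real.sqrt IK ≤ (‖curlCLM‖ + 1) * Real.sqrt ID := by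
    have hκ : 0 ≤ ‖curlCLM‖ + 1 := by positivity
    have hpt : ∀ x, ‖curl (u σ) x‖ ^ 2 ≤ (‖curlCLM‖ + 1) ^ 2 * ‖fderiv ℝ (u σ) x‖ ^ 2 := by
      intro x
      rw [← mul_pow]
      refine pow_le_pow_left₀ (norm_nonneg _) ((norm_curl_le (u σ) x).trans ?_) 2
      exact mul_le_mul_of_nonneg_right (by linarith) (norm_nonneg _)
    have hle : IK ≤ (‖curlCLM‖ + 1) ^ 2 * ID := by
      rw [hIKdef, hIDdef, ← integral_const_mul]
      exact setIntegral_mono_on (integrableOn_ball_of_continuous (hKc.norm.pow 2) R)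
        ((integrableOn_ball_of_continuous (hDc.norm.pow 2) R).const_mul _) measurableSet_ball fun x _ => hpt x
    calc Real.sqrt IK ≤ Real.sqrt ((‖curlCLM‖ + 1) ^ 2 * ID) := Real.sqrt_le_sqrt hle
      _ = (‖curlCLM‖ + 1) * Real.sqrt ID := by rw [Real.sqrt_mul' _ hID0, Real.sqrt_sq hκ]
  -- the `A`-gauge on the slice
  have h3 : Real.sqrt IU ≤ Real.sqrt ((c : ℝ) + 1) * R ^ (1 / 2 - ρ) := by
    have hgauge := Backward.lintegral_ball_le_of_gaugeA (u := u) hR (hA R hR) hσ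
    have hIU : IU ≤ (c : ℝ) * R ^ (1 - 2 * ρ) := by
      have h := ENNReal.toReal_mono ENNReal.ofReal_ne_top hgauge
      rw [← ofReal_setIntegral_norm_sq hvc R, ENNReal.toReal_ofReal hIU0,
        ENNReal.toReal_ofReal (by positivity)] at h
      exact h
    have hIU' : IU ≤ ((c : ℝ) + 1) * R ^ (1 - 2 * ρ) := by
      have : 0 ≤ R ^ (1 - 2 * ρ) := Real.rpow_nonneg hR.le _
      nlinarith
    calc Real.sqrt IU ≤ Real.sqrt (((c : ℝ) + 1) * R ^ (1 - 2 * ρ)) := Real.sqrt_le_sqrt hIU'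
      _ = Real.sqrt ((c : ℝ) + 1) * R ^ (1 / 2 - ρ) := by
          rw [Real.sqrt_mul (by positivity), Real.sqrt_eq_rpow (R ^ (1 - 2 * ρ)), ← Real.rpow_mul hR.le]
          congr 1; congr 1; ring
  -- the quantum
  have hmain := sq_ge_of_floor (ρ := ρ) hC (by positivity : 0 < ‖curlCLM‖ + 1) hV (by positivity : 0 < (c : ℝ) + 1) hR hw₀ hH
    (Real.sqrt_nonneg ID) (Real.sqrt_nonneg IK) h1 h2 h3
  rwa [Real.sq_sqrt hID0] at hmain

/-- ★ **THE PER-TIME STEP (`ℝ≥0∞` form)**: under the hypotheses of `quantum_le_enstrophy`, `ENNReal.ofReal e ≤ ∫⁻_{B_R} ‖∇u(σ)‖ₑ²`. [folklore] -/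
theorem ofReal_quantum_le_lintegral (hcl : IsClassicalEulerSolutionOn (Iio 0) 0 u p) {ρ : ℝ} {c : ℝ≥0}
    (hA : ∀ a : ℝ, 0 < a → ENNReal.ofReal (a ^ (2 * ρ)) * cknA a (0 : ℝ × EuclideanSpace ℝ (Fin 3)) u ≤ (c : ℝ≥0∞))
    {C : ℝ} (hC : 0 < C)
    (hF : ∀ R : ℝ, 0 < R → ∀ v : EuclideanSpace ℝ (Fin 3) → EuclideanSpace ℝ (Fin 3), ContDiff ℝ 1 v →
      ∀ w : EuclideanSpace ℝ (Fin 3) → ℝ, Measurable w → (∀ x : EuclideanSpace ℝ (Fin 3), |w x| ≤ 1) →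
        ∀ T : Set (EuclideanSpace ℝ (Fin 3)), MeasurableSet T → volume T < ⊤ → (∀ x : EuclideanSpace ℝ (Fin 3), x ∉ T → w x = 0) →
          |∫ x in Metric.ball (0 : EuclideanSpace ℝ (Fin 3)) R, w x * inner ℝ (v x) (curl v x)| ≤
            C * (volume T).toReal ^ (1 / 3 : ℝ) *
                (Real.sqrt (∫ x in Metric.ball (0 : EuclideanSpace ℝ (Fin 3)) R, ‖fderiv ℝ v x‖ ^ 2) +
                  R⁻¹ * Real.sqrt (∫ x in Metric.ball (0 : EuclideanSpace ℝ (Fin 3)) R, ‖v x‖ ^ 2)) *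
              Real.sqrt (∫ x in Metric.ball (0 : EuclideanSpace ℝ (Fin 3)) R, ‖curl v x‖ ^ 2))
    {R : ℝ} (hR : 0 < R) {σ : ℝ} (hσ : σ ∈ Ioo (-(R ^ 2)) 0)
    {w : EuclideanSpace ℝ (Fin 3) → ℝ} (hwm : Measurable w) (hw1 : ∀ x, |w x| ≤ 1)
    {T' : Set (EuclideanSpace ℝ (Fin 3))} (hT'm : MeasurableSet T') (hT'fin : volume T' < ⊤) (hwT' : ∀ x, x ∉ T' → w x = 0)
    {V : ℝ} (hV : 0 < V) (hT'V : (volume T').toReal ≤ V)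
    {w₀ H : ℝ} (hw₀ : 0 < w₀) (hH : 0 < H)
    (hhost : w₀ * H ≤ |∫ x in ball (0 : EuclideanSpace ℝ (Fin 3)) R, w x * ⟪u σ x, curl (u σ) x⟫|) :
    ENNReal.ofReal (min (w₀ * H / (2 * C * (‖curlCLM‖ + 1) * V ^ (1 / 3 : ℝ)))
        ((w₀ * H) ^ 2 * R ^ (1 + 2 * ρ) / (4 * C ^ 2 * (‖curlCLM‖ + 1) ^ 2 * ((c : ℝ) + 1) * V ^ (2 / 3 : ℝ)))) ≤
      ∫⁻ x in ball (0 : EuclideanSpace ℝ (Fin 3)) R, ‖fderiv ℝ (u σ) x‖ₑ ^ 2 := by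
  have hDc : Continuous (fderiv ℝ (u σ)) := (hcl.contDiff_velocity hσ.2).continuous_fderiv (by simp)
  rw [← ofReal_setIntegral_norm_sq hDc R]
  exact ENNReal.ofReal_le_ofReal
    (quantum_le_enstrophy hcl hA hC hF hR hσ hwm hw1 hT'm hT'fin hwT' hV hT'V hw₀ hH hhost)

end Summit.NavierStokesRegularity.NavierStokesRegularity.Theorems.PowerGaugeEulerLiouville.ChiralAnchor

end
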